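import Summits.ValiantsHypothesis.ValiantsHypothesis.Theses.FeketeSOS
import Summits.ValiantsHypothesis.ValiantsHypothesis.Theorems.FeketeNoSparseSplit.Negative.SmallModels
import Literature.NumberTheory.LFunctions.FeketePolynomial

/-!
# `FeketeNoSparseSplit` (crux stmt-ValiantsHypothesis-3997): the peel deficiency — NATURAL STRENGTHENINGS
`≥ p - 1`, `≥ p - 2` eventually are FALSE (cdisprove cycle 3)

Negative-side boundary facts (refuter-cdisprove-stmt-ValiantsHypothesis-3997-g3-0), PROVED, no new facts; sharpens
`Negative/SmallModels.not_eventuallyTrivialOptimal` (cycle 1: `≥ p` eventually is false).  The `(X - X²)`-peel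
`F_p = (X - X²)·Σ_k S_p(k+1) X^k` (`S_p(k) = Σ_{m≤k} χ_p(m)`) has support-sum `p - Z_p`, `Z_p = #{1 ≤ k ≤ p-2 : S_p(k) = 0}`.
Here: `χ_p(2) = -1` (i.e. `p ≡ ±3 mod 8`) forces the two zeros `S_p(2) = 0` and `S_p(p-3) = -(χ_p(-2) + χ_p(-1)) = 0`
(`sum_range_three_legendreSym_eq_zero`, `sum_range_sub_two_legendreSym_eq_zero`), so `peel_split_le_sub_two`: support-sum
`≤ p - 2` for every prime `p ≡ 3, 5 (mod 8)`, `p ≥ 11`; and for `p ≡ 5 (mod 8)` the central zero `S_p((p-1)/2) = 0`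
(`sum_half_legendreSym_eq_zero`, cycle 1) is a third one, `peel_split_le_sub_three`: `≤ p - 3` (`p ≥ 13`).  With
Dirichlet's theorem for `5 mod 8` (Mathlib `Nat.forall_exists_prime_gt_and_modEq`): `not_eventually_ge_sub_two` — even
`∃ p₀ ∀ p ≥ p₀, p - 2 ≤ |supp A| + |supp B|` is FALSE.  Numerics (cycle 3, `p < 4000`): `Z_p ≥ 3` for all `p ≡ 1, 5 (8)` with
`p ≥ 13`, `≥ 2` for `p ≡ 3 (8)` with `p ≥ 11`, but `Z_p = 0` for 92 of the 139 primes `p ≡ 7 (8)` (positivity bias of `S_p`); mean `Z_p/√p ≈ 1.28`,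
`max Z_p/p ≈ 0.065`: the deficiency is `Θ(√p)`-sized on average and never an exponent — consistent with the crux and
the line, and with "trivial splittings optimal for infinitely many `p ≡ 7 (8)`" being plausible but tied to the open
positivity problem for Legendre partial sums (Baker–Montgomery).
-/

namespace Summit.ValiantsHypothesis.Theorems.FeketeNoSparseSplit.Negative

open Polynomial Finset

section PeelDeficiency

variable (p : ℕ) [Fact p.Prime]

/-- `χ_p(2) = -1` for `p ≡ 3, 5 (mod 8)` (second supplement). -/
theorem legendreSym_two_eq_neg_one (h8 : p % 8 = 3 ∨ p % 8 = 5) : legendreSym p 2 = -1 := by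
  have hp2 : p ≠ 2 := by rintro rfl; norm_num at h8
  rw [legendreSym.at_two hp2, ZMod.χ₈_nat_eq_if_mod_eight]
  have hodd : p % 2 ≠ 0 := by omega
  rw [if_neg hodd, if_neg (by omega)]

/-- `S_p(2) = χ_p(0) + χ_p(1) + χ_p(2) = 0` when `χ_p(2) = -1`. -/
theorem sum_range_three_legendreSym_eq_zero (h2 : legendreSym p 2 = -1) :
    ∑ m ∈ range 3, legendreSym p m = 0 := by
  simp [Finset.sum_range_succ, legendreSym.at_zero, legendreSym.at_one]
  rw [h2]
  norm_num

/-- `S_p(p-3) = -(χ_p(p-2) + χ_p(p-1)) = -χ_p(-1)·(χ_p(2) + 1) = 0` when `χ_p(2) = -1` (`p ≥ 3`). -/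
theorem sum_range_sub_two_legendreSym_eq_zero (h2 : legendreSym p 2 = -1) (hp3 : 3 ≤ p) :
    ∑ m ∈ range (p - 2), legendreSym p m = 0 := by
  have hp2 : p ≠ 2 := by omega
  have htot := Literature.NumberTheory.LFunctions.sum_range_legendreSym p hp2
  have hr : Finset.range p = Finset.range (p - 2 + 1 + 1) := by congr 1; omega
  rw [hr, Finset.sum_range_succ, Finset.sum_range_succ] at htot
  have e1 : (p - 2 + 1 : ℕ) = p - 1 := by omega
  have hm1 : legendreSym p ((p - 2 + 1 : ℕ) : ℤ) = legendreSym p (-1) := by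
    rw [e1, Literature.NumberTheory.LFunctions.legendreSym_natCast_sub p (by omega : 1 ≤ p)]
    norm_num
  have hm2 : legendreSym p ((p - 2 : ℕ) : ℤ) = -legendreSym p (-1) := by
    rw [Literature.NumberTheory.LFunctions.legendreSym_natCast_sub p (by omega : 2 ≤ p),
      show (-(2 : ℕ) : ℤ) = (-1) * 2 by norm_num, legendreSym.mul, h2]
    ring
  rw [hm1, hm2] at htot
  linarith

/-- **Peel with two forced zeros**: for every prime `p ≡ 3, 5 (mod 8)` with `p ≥ 11` there is a splitting of `F_p`
with support-sum `≤ p - 2` (the peel; `S_p(2) = S_p(p-3) = 0`). -/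
theorem peel_split_le_sub_two (h8 : p % 8 = 3 ∨ p % 8 = 5) (hp11 : 11 ≤ p) : ∃ A B : ℂ[X],
    A * B = ∑ m ∈ Finset.range p, C ((legendreSym p m : ℤ) : ℂ) * X ^ m ∧
    A.support.card + B.support.card ≤ p - 2 := by
  have hp2 : p ≠ 2 := by omega
  have h2 := legendreSym_two_eq_neg_one p h8
  obtain ⟨A, B, hAB, hA, hB⟩ := peel_split p hp2
  refine ⟨A, B, hAB, ?_⟩
  have hsub : (range (p - 2)).filter (fun k => ∑ m ∈ range (k + 2), legendreSym p m ≠ 0)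
      ⊆ (range (p - 2)) \ {1, p - 4} := by
    intro k hk
    rw [Finset.mem_filter] at hk
    rw [Finset.mem_sdiff, Finset.mem_insert, Finset.mem_singleton]
    refine ⟨hk.1, ?_⟩
    rintro (rfl | rfl)
    · exact hk.2 (sum_range_three_legendreSym_eq_zero p h2)
    · apply hk.2
      rw [show p - 4 + 2 = p - 2 by omega]
      exact sum_range_sub_two_legendreSym_eq_zero p h2 (by omega)
  have hcard := Finset.card_le_card hsub
  have hin : ({1, p - 4} : Finset ℕ) ⊆ range (p - 2) := by
    intro x hx
    rw [Finset.mem_insert, Finset.mem_singleton] at hx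
    rw [Finset.mem_range]; omega
  rw [Finset.card_sdiff_of_subset hin, Finset.card_range, Finset.card_pair (by omega)] at hcard
  omega

/-- **Peel with three forced zeros**: for every prime `p ≡ 5 (mod 8)` with `p ≥ 13` there is a splitting of `F_p`
with support-sum `≤ p - 3` (`S_p(2) = S_p((p-1)/2) = S_p(p-3) = 0`). -/
theorem peel_split_le_sub_three (h8 : p % 8 = 5) (hp13 : 13 ≤ p) : ∃ A B : ℂ[X],
    A * B = ∑ m ∈ Finset.range p, C ((legendreSym p m : ℤ) : ℂ) * X ^ m ∧
    A.support.card + B.support.card ≤ p - 3 := by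
  have hp2 : p ≠ 2 := by omega
  have h2 := legendreSym_two_eq_neg_one p (Or.inr h8)
  have hp4 : p % 4 = 1 := by omega
  obtain ⟨A, B, hAB, hA, hB⟩ := peel_split p hp2
  refine ⟨A, B, hAB, ?_⟩
  have hsub : (range (p - 2)).filter (fun k => ∑ m ∈ range (k + 2), legendreSym p m ≠ 0)
      ⊆ (range (p - 2)) \ {1, (p - 3) / 2, p - 4} := by
    intro k hk
    rw [Finset.mem_filter] at hk
    rw [Finset.mem_sdiff, Finset.mem_insert, Finset.mem_insert, Finset.mem_singleton]
    refine ⟨hk.1, ?_⟩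
    rintro (rfl | rfl | rfl)
    · exact hk.2 (sum_range_three_legendreSym_eq_zero p h2)
    · apply hk.2
      rw [show (p - 3) / 2 + 2 = (p + 1) / 2 by omega]
      exact sum_half_legendreSym_eq_zero p hp4
    · apply hk.2
      rw [show p - 4 + 2 = p - 2 by omega]
      exact sum_range_sub_two_legendreSym_eq_zero p h2 (by omega)
  have hcard := Finset.card_le_card hsub
  have hin : ({1, (p - 3) / 2, p - 4} : Finset ℕ) ⊆ range (p - 2) := by
    intro x hx
    rw [Finset.mem_insert, Finset.mem_insert, Finset.mem_singleton] at hx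
    rw [Finset.mem_range]; omega
  have h3 : ({1, (p - 3) / 2, p - 4} : Finset ℕ).card = 3 := by
    rw [Finset.card_insert_of_notMem, Finset.card_pair (by omega)]
    rw [Finset.mem_insert, Finset.mem_singleton]; omega
  rw [Finset.card_sdiff_of_subset hin, Finset.card_range, h3] at hcard
  omega

/-- **NATURAL STRENGTHENING REFUTED, eventual form sharpened**: even `∃ p₀ ∀ primes p ≥ p₀, every splitting has
support-sum ≥ p - 2` is FALSE — along the primes `p ≡ 5 (mod 8)` (Dirichlet, Mathlib) the peel has support-sum `≤ p - 3`.
(Cycle 1's `not_eventuallyTrivialOptimal` refuted `≥ p`; the true deficiency `p - min` is unbounded but `O(√p)` on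
average numerically, never an exponent.) -/
theorem not_eventually_ge_sub_two :
    ¬ ∃ p₀ : ℕ, ∀ (p : ℕ) [Fact p.Prime], p₀ ≤ p → ∀ (A B : ℂ[X]),
      A * B = ∑ m ∈ Finset.range p, C ((legendreSym p m : ℤ) : ℂ) * X ^ m →
        (p : ℝ) - 2 ≤ (A.support.card : ℝ) + (B.support.card : ℝ) := by
  rintro ⟨p₀, H⟩
  obtain ⟨q, hgt, hq, hmod⟩ := Nat.forall_exists_prime_gt_and_modEq (p₀ + 13) (q := 8) (a := 5) (by norm_num)
    (by norm_num)
  haveI : Fact q.Prime := ⟨hq⟩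
  have hq8 : q % 8 = 5 := by
    have := hmod; unfold Nat.ModEq at this; simpa using this
  obtain ⟨A, B, hAB, hle⟩ := peel_split_le_sub_three q hq8 (by omega)
  have h := H q (by omega) A B hAB
  have h' : ((A.support.card : ℝ) + (B.support.card : ℝ)) ≤ (q : ℝ) - 3 := by
    have hq3 : 3 ≤ q := by omega
    have : ((A.support.card + B.support.card : ℕ) : ℝ) ≤ ((q - 3 : ℕ) : ℝ) := by exact_mod_cast hle
    push_cast [Nat.cast_sub hq3] at this
    exact this
  linarith

end PeelDeficiency

end Summit.ValiantsHypothesis.Theorems.FeketeNoSparseSplit.Negative
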